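import Summits.HubbardSuperconductivity.HubbardSuperconductivity.Theorems.DeformationLadderLadderThesisRigidityReduction

/-!
# Route `DeformationLadder`, support `PairingMonotonicity` (item `stmt-HubbardSuperconductivity-1896`)

The finite-`L` two-line variational lemma along the number-conserving family
`K_L(U,g) = hubbardTorus 2 L 1 U − (g/L²)·Δ_dᴴΔ_d` (Kaplan–Horsch–von der Linden): for `g₁ < g₂` and
normalised ground states `φ₁` of `K(g₁)`, `φ₂` of `K(g₂)` in the same `(N, S^z = 0)` sector,
`Re⟨φ₁, Δ_dᴴΔ_d φ₁⟩ ≤ Re⟨φ₂, Δ_dᴴΔ_d φ₂⟩`. Proof: with `Eᵢ` the sector energies and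
`pᵢ = Re⟨φᵢ, Δ_dᴴΔ_d φᵢ⟩`, the variational principle gives `E₂ ≤ E₁ − (g₂−g₁)L⁻² p₁` and
`E₁ ≤ E₂ + (g₂−g₁)L⁻² p₂`; add. This is concavity of `g ↦ minEnergyOn K_L(U,g)` on the sector.

Sources: T. A. Kaplan, P. Horsch, W. von der Linden, J. Phys. Soc. Jpn. 58 (1989) 3894;
P. Horsch, W. von der Linden, Z. Phys. B 72 (1988) 181; H. Tasaki, J. Stat. Phys. 174 (2019) 735, §2.
-/

set_option linter.dupNamespace false

noncomputable section

namespace Summit.HubbardSuperconductivity.HubbardSuperconductivity.Theorems.DeformationLadder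

open Matrix Literature.MathematicalPhysics.QuantumLattice Literature.Probability.LatticeModels
open Summit.HubbardSuperconductivity.HubbardSuperconductivity.Theses.DeformationLadder

/-- The Rayleigh value of the deformed Hamiltonian `H_L − (g/L²)·P` splits as
`Re⟨φ, H_L φ⟩ − (g/L²)·Re⟨φ, P φ⟩`. [folklore] -/
theorem re_rayleigh_deformed (L : ℕ) [NeZero L] (U g : ℝ)
    (φ : Fock (Orb (FermionTorus 2 L))) :
    (star φ ⬝ᵥ (hubbardTorus 2 L 1 U - ((g / (L : ℝ) ^ 2 : ℝ) : ℂ) •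
        ((pairField dWaveFormFactor L)ᴴ * pairField dWaveFormFactor L)) *ᵥ φ).re =
      (star φ ⬝ᵥ hubbardTorus 2 L 1 U *ᵥ φ).re -
        g / (L : ℝ) ^ 2 *
          (star φ ⬝ᵥ ((pairField dWaveFormFactor L)ᴴ * pairField dWaveFormFactor L) *ᵥ φ).re := by
  rw [sub_mulVec, dotProduct_sub, Complex.sub_re, smul_mulVec, dotProduct_smul, smul_eq_mul,
    Complex.re_ofReal_mul]

/-- **`PairingMonotonicity` holds** (route `DeformationLadder`, support item
`stmt-HubbardSuperconductivity-1896`): along the family `K_L(U,g) = H_L − (g/L²)·Δ_dᴴΔ_d`, for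
`g₁ < g₂` and normalised sector ground states `φ₁` of `K(g₁)`, `φ₂` of `K(g₂)` in the same
`(N, S^z = 0)` sector, `Re⟨φ₁, Δ_dᴴΔ_d φ₁⟩ ≤ Re⟨φ₂, Δ_dᴴΔ_d φ₂⟩` — the Kaplan–Horsch–von der Linden
two-line variational comparison (concavity of the sector ground energy in `g`).
[cite: KaplanHorschVonDerLinden1989] -/
theorem pairingMonotonicity_proof : PairingMonotonicity := by
  intro L _ U N g₁ g₂ hg φ₁ φ₂ hφ₁ hφ₂ h₁ h₂
  obtain ⟨hmem₁, -, heig₁⟩ := h₁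
  obtain ⟨hmem₂, -, heig₂⟩ := h₂
  set P := (pairField dWaveFormFactor L)ᴴ * pairField dWaveFormFactor L with hP
  set K₁ := hubbardTorus 2 L 1 U - ((g₁ / (L : ℝ) ^ 2 : ℝ) : ℂ) • P with hK₁
  set K₂ := hubbardTorus 2 L 1 U - ((g₂ / (L : ℝ) ^ 2 : ℝ) : ℂ) • P with hK₂
  set E₁ := K₁.minEnergyOn (szSector N 0) with hE₁
  set E₂ := K₂.minEnergyOn (szSector N 0) with hE₂
  have hL : (0 : ℝ) < (L : ℝ) ^ 2 := by
    have : (0 : ℝ) < L := by exact_mod_cast Nat.pos_of_ne_zero (NeZero.ne L)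
    positivity
  -- the ground-state energies as Rayleigh values
  have hR₁ : (star φ₁ ⬝ᵥ K₁ *ᵥ φ₁).re = E₁ := by
    rw [heig₁, dotProduct_smul, hφ₁, smul_eq_mul, mul_one, Complex.ofReal_re]
  have hR₂ : (star φ₂ ⬝ᵥ K₂ *ᵥ φ₂).re = E₂ := by
    rw [heig₂, dotProduct_smul, hφ₂, smul_eq_mul, mul_one, Complex.ofReal_re]
  -- the variational principle, crosswise
  have hV₁ : E₂ ≤ (star φ₁ ⬝ᵥ K₂ *ᵥ φ₁).re := minEnergyOn_le_re_rayleigh K₂ _ hmem₁ hφ₁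
  have hV₂ : E₁ ≤ (star φ₂ ⬝ᵥ K₁ *ᵥ φ₂).re := minEnergyOn_le_re_rayleigh K₁ _ hmem₂ hφ₂
  rw [hK₁, re_rayleigh_deformed] at hR₁ hV₂
  rw [hK₂, re_rayleigh_deformed] at hR₂ hV₁
  -- bookkeeping: (g₂ - g₁)/L² · (p₂ - p₁) ≥ 0
  set p₁ := (star φ₁ ⬝ᵥ P *ᵥ φ₁).re with hp₁
  set p₂ := (star φ₂ ⬝ᵥ P *ᵥ φ₂).re with hp₂
  have hkey : 0 ≤ (g₂ - g₁) / (L : ℝ) ^ 2 * (p₂ - p₁) := by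
    have : (g₂ - g₁) / (L : ℝ) ^ 2 * (p₂ - p₁) =
        (g₂ / (L : ℝ) ^ 2 * p₂ - g₁ / (L : ℝ) ^ 2 * p₂) -
          (g₂ / (L : ℝ) ^ 2 * p₁ - g₁ / (L : ℝ) ^ 2 * p₁) := by ring
    rw [this]
    linarith
  have hpos : 0 < (g₂ - g₁) / (L : ℝ) ^ 2 := div_pos (by linarith) hL
  have : 0 ≤ p₂ - p₁ := by
    by_contra hneg
    push Not at hneg
    have := mul_neg_of_pos_of_neg hpos hneg
    linarith
  show p₁ ≤ p₂
  linarith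

end Summit.HubbardSuperconductivity.HubbardSuperconductivity.Theorems.DeformationLadder
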